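import Literature.NumberTheory.Sieve.MaynardSieveBilinear
import Literature.NumberTheory.Sieve.MaynardSieveTuples
import Literature.NumberTheory.Sieve.MaynardSieveWeightsM
import Literature.NumberTheory.Sieve.MaynardSieve
import Literature.NumberTheory.Sieve.PolymathLcmSums
import HarnessLib

/-!
# Maynard 2015, Lemma 5.1: the residue-class count behind `S₁`

J. Maynard, *Small gaps between primes*, Ann. of Math. (2) 181 (2015), 383–413 = arXiv:1311.4600,
proof of Lemma 5.1 (pp. 9–10 of the arXiv text), first half: "We expand out the square, and swap
the order of summation ... by the Chinese remainder theorem, the inner sum can be written as a sum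
over a single residue class modulo `q = W ∏ᵢ [dᵢ, eᵢ]`, provided that the integers
`W, [d₁, e₁], …, [d_k, e_k]` are pairwise coprime. The integers are pairwise coprime, as otherwise
the conditions on the support of `λ` mean one of `λ_d, λ_e` is zero (here we use `p ∣ hᵢ − hⱼ`
`⇒ p ≤ D₀ ⇒ p ∣ W`). The inner sum then contributes `N/q + O(1)`", giving display (5.1):
`S₁ = (N/W) Σ' λ_d λ_e / ∏ᵢ [dᵢ, eᵢ] + O((Σ_d |λ_d|)²)`.

This file proves that half for an ARBITRARY coefficient vector `y` supported on good tuples of the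
box `[1, B]^k` (`MaynardSieveBilinear.SupportedOn`), with `λ = lam B y`; combined with the
diagonalisation `Literature.NumberTheory.Sieve.MaynardSieve.abs_S1main_sub_le` of `MaynardSieveBilinear.lean` (the second
half of the printed proof, (5.2)–(5.7)) it yields the complete combinatorial content of Lemma 5.1,
`abs_S1_sub_main_le`:

`|S₁ − (N/W) Σ_u y_u² / ∏ φ(uᵢ)| ≤ (N/W) · y_max² L^k (Z^{k²−k} − 1) + (Σ_d |λ_d|)²`,

`L = Σ_{n ≤ B good} 1/φ(n)`, `Z = Σ_{n ≤ B good} 1/φ(n)²`, together with the support bound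
`Σ_d |λ_d| ≤ y_max L^{2k} · X (1 + log X)^{k−1}` when `y` lives on tuples of product `≤ X`
(`sum_abs_lam_le_of_prod_le`, from `abs_lam_le` and `Literature.NumberTheory.Sieve.MaynardTao.card_prodLeTuples_le`).
The last section specialises to Maynard's weights `λ_d = maynardWeight k F R W d`
(`F = G · 1_{R_k}`): `abs_maynardS1_sub_main_le`, the non-asymptotic form of the named fact
`Literature.NumberTheory.Sieve.maynard_lemma51` (`MaynardSieveS1.lean`); what remains for that fact is the bookkeeping
`L ≪ (φ(W)/W) log R`, `Z^{k²} − 1 ≪ k²/D₀` (`CoprimeSquarefreeSumsBounds.lean`) and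
`R² (log R)^{C} = o(N/(W D₀))`.

Contents:
* `S1 W B y h v₀ N`, `cnt W h v₀ N d e`; `S1_eq_sum_cnt`, `S1_eq_sum_boxG` (expand the square);
* `cnt_eq_zero_of_not_coprime` (incompatible pairs), `abs_cnt_sub_le` (`N/q + O(1)`, through the
  Chinese remainder theorem `Literature.NumberTheory.Sieve.exists_forall_modEq_iff_modEq_prod` of `PolymathLcmSums.lean` and
  the residue-class count `Literature.NumberTheory.Sieve.MaynardTao.abs_card_filter_modEq_sub_le` of `MaynardSieveTuples.lean`);
* `abs_S1_sub_bilinear_le` ((5.1)), `abs_S1_sub_main_le` (Lemma 5.1, combinatorial form);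
* `sum_abs_lam_le_of_prod_le`; `maynardS1_eq_S1`, `supportedOn_maynardY`, `abs_maynardY_le`,
  `prod_le_of_maynardY_ne_zero`, `abs_maynardS1_sub_main_le`.

## References

* J. Maynard, *Small gaps between primes*, Ann. of Math. (2) 181 (2015), 383–413,
  doi:10.4007/annals.2015.181.1.7 = arXiv:1311.4600; Lemma 5.1 and its proof, display (5.1),
  pp. 9–10. [cite: MaynardAnnals2015]
-/

open Finset
open scoped BigOperators ArithmeticFunction.Moebius

namespace Literature.NumberTheory.Sieve
namespace MaynardSieve

variable {k : ℕ}

/-! ### Residue classes: from `ℤ` to `ℕ` -/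

/-- For `q ≥ 1` and an integer residue `a`: `n ≡ a (mod q)` in `ℤ` iff `n ≡ (a mod q)` in `ℕ`.
[folklore] -/
theorem natCast_modEq_iff_modEq_toNat {q : ℕ} (hq : q ≠ 0) (n : ℕ) (a : ℤ) :
    (n : ℤ) ≡ a [ZMOD q] ↔ n ≡ Int.toNat (a % (q : ℤ)) [MOD q] := by
  have hq' : (q : ℤ) ≠ 0 := by exact_mod_cast hq
  rw [← Int.natCast_modEq_iff, Int.toNat_of_nonneg (Int.emod_nonneg _ hq')]
  have hm : a % (q : ℤ) ≡ a [ZMOD q] := Int.mod_modEq _ _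
  exact ⟨fun H => H.trans hm.symm, fun H => H.trans hm⟩

/-! ### `S₁` and the residue-class count -/

/-- `S₁ = Σ_{N ≤ n < 2N, n ≡ v₀ (W)} (Σ_{d in the box, dᵢ ∣ n + hᵢ ∀ i} λ_d)²` for `λ = lam B y`
(Maynard 2015 §4, p. 7, the display defining `S₁`, with the `dᵢ` restricted to the box `[1, B]`,
outside which `λ_d = 0`). For `B = ⌊R⌋`, `y = maynardY k F R W` this is `maynardS1`
(`maynardS1_eq_S1`). [cite: MaynardAnnals2015, §4, definition of S₁ (p. 7)] -/
noncomputable def S1 (W B : ℕ) (y : (Fin k → ℕ) → ℝ) (h : Fin k → ℤ) (v₀ N : ℕ) : ℝ :=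
  ∑ n ∈ (Finset.Ico N (2 * N)).filter (fun n => n ≡ v₀ [MOD W]),
    (∑ d ∈ (box k B).filter (fun d => ∀ i, ((d i : ℕ) : ℤ) ∣ (n : ℤ) + h i), lam B y d) ^ 2

/-- The inner count after expanding the square: `#{N ≤ n < 2N : n ≡ v₀ (W), dᵢ, eᵢ ∣ n + hᵢ ∀ i}`
(Maynard 2015, first display of the proof of Lemma 5.1, p. 9).
[cite: MaynardAnnals2015, proof of Lemma 5.1] -/
def cnt (W : ℕ) (h : Fin k → ℤ) (v₀ N : ℕ) (d e : Fin k → ℕ) : ℕ :=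
  ((Finset.Ico N (2 * N)).filter fun n => n ≡ v₀ [MOD W] ∧
      ∀ i, ((d i : ℕ) : ℤ) ∣ (n : ℤ) + h i ∧ ((e i : ℕ) : ℤ) ∣ (n : ℤ) + h i).card

/-- **Expanding the square** (Maynard 2015, proof of Lemma 5.1, first display):
`S₁ = Σ_{d, e} λ_d λ_e #{n : n ≡ v₀ (W), [dᵢ, eᵢ] ∣ n + hᵢ ∀ i}`.
[cite: MaynardAnnals2015, proof of Lemma 5.1] -/
theorem S1_eq_sum_cnt (W B : ℕ) (y : (Fin k → ℕ) → ℝ) (h : Fin k → ℤ) (v₀ N : ℕ) :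
    S1 W B y h v₀ N =
      ∑ d ∈ box k B, ∑ e ∈ box k B, lam B y d * lam B y e * (cnt W h v₀ N d e : ℝ) := by
  classical
  unfold S1
  have hsq : ∀ n : ℕ,
      (∑ d ∈ (box k B).filter (fun d => ∀ i, ((d i : ℕ) : ℤ) ∣ (n : ℤ) + h i), lam B y d) ^ 2 =
        ∑ d ∈ box k B, ∑ e ∈ box k B,
          if (∀ i, ((d i : ℕ) : ℤ) ∣ (n : ℤ) + h i ∧ ((e i : ℕ) : ℤ) ∣ (n : ℤ) + h i) then
            lam B y d * lam B y e else 0 := by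
    intro n
    rw [sq, Finset.sum_filter, Finset.sum_mul_sum]
    refine sum_congr rfl fun d _ => sum_congr rfl fun e _ => ?_
    by_cases hd : ∀ i, ((d i : ℕ) : ℤ) ∣ (n : ℤ) + h i <;>
      by_cases he : ∀ i, ((e i : ℕ) : ℤ) ∣ (n : ℤ) + h i <;> simp [hd, he, forall_and]
  simp_rw [hsq]
  rw [Finset.sum_comm]
  refine sum_congr rfl fun d _ => ?_
  rw [Finset.sum_comm]
  refine sum_congr rfl fun e _ => ?_
  rw [← Finset.sum_filter, Finset.filter_filter, Finset.sum_const, nsmul_eq_mul, mul_comm]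
  rfl

/-- Only good tuples contribute (`λ_d = 0` off `boxG`, `lam_eq_zero_of_not`).
[cite: MaynardAnnals2015, proof of Lemma 5.1] -/
theorem S1_eq_sum_boxG {W B : ℕ} {y : (Fin k → ℕ) → ℝ} (hy : SupportedOn W B y)
    (h : Fin k → ℤ) (v₀ N : ℕ) :
    S1 W B y h v₀ N =
      ∑ d ∈ boxG k W B, ∑ e ∈ boxG k W B, lam B y d * lam B y e * (cnt W h v₀ N d e : ℝ) := by
  rw [S1_eq_sum_cnt]
  have hsub : boxG k W B ⊆ box k B := Finset.filter_subset _ _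
  symm
  rw [Finset.sum_subset hsub fun d _ hd => ?_]
  · refine sum_congr rfl fun d _ => Finset.sum_subset hsub fun e _ he => ?_
    rw [lam_eq_zero_of_not hy he, mul_zero, zero_mul]
  · exact Finset.sum_eq_zero fun e _ => by rw [lam_eq_zero_of_not hy hd, zero_mul, zero_mul]

/-- **Incompatible pairs count nothing**: if some `dᵢ`, `eⱼ` (`i ≠ j`) share a prime `p`, then no
`n` has `dᵢ ∣ n + hᵢ` and `eⱼ ∣ n + hⱼ` — such a `p` divides `hᵢ − hⱼ`, hence (hypothesis `hh`,
Maynard's "`p ≤ D₀`") divides `W`, contradicting `(dᵢ, W) = 1` (Maynard 2015, proof of Lemma 5.1: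
"the integers are pairwise coprime, as otherwise ... one of `λ_d`, `λ_e` is zero").
[cite: MaynardAnnals2015, proof of Lemma 5.1] -/
theorem cnt_eq_zero_of_not_coprime {W : ℕ} {h : Fin k → ℤ}
    (hh : ∀ i j, i ≠ j → ∀ p : ℕ, p.Prime → (p : ℤ) ∣ h i - h j → p ∣ W) (v₀ N : ℕ)
    {d e : Fin k → ℕ} (hd : IsGood W d) {p : OffDiag k} (hp : ¬(d p.1.1).Coprime (e p.1.2)) :
    cnt W h v₀ N d e = 0 := by
  rw [cnt, Finset.card_eq_zero, Finset.filter_eq_empty_iff]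
  rintro n - ⟨-, hn⟩
  obtain ⟨⟨i, j⟩, hij⟩ := p
  simp only at hp hij
  rw [Nat.Prime.not_coprime_iff_dvd] at hp
  obtain ⟨q, hq, hqd, hqe⟩ := hp
  have h1 : (q : ℤ) ∣ (n : ℤ) + h i := (Int.natCast_dvd_natCast.2 hqd).trans (hn i).1
  have h2 : (q : ℤ) ∣ (n : ℤ) + h j := (Int.natCast_dvd_natCast.2 hqe).trans (hn j).2
  have h3 : (q : ℤ) ∣ h i - h j := by
    have := dvd_sub h1 h2
    rwa [add_sub_add_left_eq_sub] at this
  have hqW : q ∣ W := hh i j hij q hq h3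
  have hq1 : q = 1 := (Nat.Coprime.coprime_dvd_left hqd (hd.coprime_apply i)).eq_one_of_dvd hqW
  exact hq.one_lt.ne' hq1

/-- **The count in one residue class** (Maynard 2015, proof of Lemma 5.1: "the inner sum can be
written as a sum over a single residue class modulo `q = W ∏ [dᵢ, eᵢ]` ... The inner sum then
contributes `N/q + O(1)`"): for good `d, e` with `(dᵢ, eⱼ) = 1` (`i ≠ j`),
`|#{N ≤ n < 2N : n ≡ v₀ (W), dᵢ, eᵢ ∣ n + hᵢ} − N/(W ∏ [dᵢ, eᵢ])| ≤ 1`.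
[cite: MaynardAnnals2015, proof of Lemma 5.1] -/
theorem abs_cnt_sub_le {W : ℕ} (hW : W ≠ 0) {d e : Fin k → ℕ} (hd : IsGood W d)
    (he : IsGood W e) (hc : ∀ p : OffDiag k, (d p.1.1).Coprime (e p.1.2)) (h : Fin k → ℤ)
    (v₀ N : ℕ) :
    |(cnt W h v₀ N d e : ℝ) - (N : ℝ) / ((W : ℝ) * ∏ i, (Nat.lcm (d i) (e i) : ℝ))| ≤ 1 := by
  classical
  -- the moduli `Lᵢ = [dᵢ, eᵢ]`: nonzero, coprime to `W`, pairwise coprime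
  set L : Fin k → ℕ := fun i => Nat.lcm (d i) (e i) with hL
  have hL0 : ∀ i, L i ≠ 0 := fun i => Nat.lcm_ne_zero (hd.ne_zero i) (he.ne_zero i)
  have hLW : ∀ i, (L i).Coprime W := fun i =>
    Nat.Coprime.coprime_dvd_left (Nat.lcm_dvd_mul (d i) (e i))
      (Nat.Coprime.mul_left (hd.coprime_apply i) (he.coprime_apply i))
  have hLL : ∀ i j, i ≠ j → (L i).Coprime (L j) := fun i j hij => by
    have hdd := hd.coprime_of_ne hij
    have hee := he.coprime_of_ne hij
    have hde : (d i).Coprime (e j) := hc ⟨(i, j), hij⟩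
    have hed : (e i).Coprime (d j) := (hc ⟨(j, i), hij.symm⟩).symm
    refine Nat.Coprime.coprime_dvd_left (Nat.lcm_dvd_mul _ _)
      (Nat.Coprime.coprime_dvd_right (Nat.lcm_dvd_mul _ _) ?_)
    exact Nat.Coprime.mul_left (Nat.Coprime.mul_right hdd hde) (Nat.Coprime.mul_right hed hee)
  -- CRT: one residue class modulo `q = W ∏ Lᵢ`
  obtain ⟨a, ha⟩ := Literature.NumberTheory.Sieve.exists_forall_modEq_iff_modEq_prod (Finset.univ : Finset (Fin k)) W L
    (fun i => -h i) (v₀ : ℤ) (fun i _ => hLW i) fun i _ j _ hij => hLL i j hij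
  have hq0 : W * ∏ i, L i ≠ 0 := mul_ne_zero hW (Finset.prod_ne_zero_iff.2 fun i _ => hL0 i)
  have hq : 0 < W * ∏ i, L i := Nat.pos_of_ne_zero hq0
  set z : ℕ := Int.toNat (a % ((W * ∏ i, L i : ℕ) : ℤ)) with hz
  have hfilter : (Finset.Ico N (2 * N)).filter (fun n => n ≡ v₀ [MOD W] ∧
        ∀ i, ((d i : ℕ) : ℤ) ∣ (n : ℤ) + h i ∧ ((e i : ℕ) : ℤ) ∣ (n : ℤ) + h i) =
      (Finset.Ico N (2 * N)).filter (fun n => n ≡ z [MOD W * ∏ i, L i]) := by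
    refine Finset.filter_congr fun n _ => ?_
    rw [← natCast_modEq_iff_modEq_toNat hq0, ← ha n, ← Int.natCast_modEq_iff]
    simp only [Finset.mem_univ, forall_true_left]
    refine and_congr_right fun _ => forall_congr' fun i => ?_
    rw [Int.modEq_iff_dvd, show -h i - (n : ℤ) = -((n : ℤ) + h i) by ring, dvd_neg]
    simp only [hL, Int.natCast_dvd, Nat.lcm_dvd_iff]
  -- count the residue class in `[N, 2N)`
  have hcount := Literature.NumberTheory.Sieve.MaynardTao.abs_card_filter_modEq_sub_le (N : ℤ) ((2 * N : ℕ) : ℤ) (z : ℤ)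
    (by push_cast; omega) (r := ((W * ∏ i, L i : ℕ) : ℤ)) (by exact_mod_cast hq)
  have hcardeq : (((Finset.Ico (N : ℤ) ((2 * N : ℕ) : ℤ)).filter
        (fun x => x ≡ (z : ℤ) [ZMOD ((W * ∏ i, L i : ℕ) : ℤ)])).card) =
      ((Finset.Ico N (2 * N)).filter (fun n => n ≡ z [MOD W * ∏ i, L i])).card := by
    rw [← Nat.Ico_filter_modEq_cast, Finset.card_map]
  rw [hcardeq, ← hfilter] at hcount
  have hmain : (((2 * N : ℕ) : ℤ) : ℝ) - ((N : ℤ) : ℝ) = (N : ℝ) := by push_cast; ring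
  have hqR : ((((W * ∏ i, L i : ℕ) : ℤ)) : ℝ) = (W : ℝ) * ∏ i, (Nat.lcm (d i) (e i) : ℝ) := by
    push_cast; rfl
  rw [hmain, hqR] at hcount
  exact hcount

/-- **Display (5.1)** (Maynard 2015, proof of Lemma 5.1):
`|S₁ − (N/W) Σ'_{d,e} λ_d λ_e / ∏ [dᵢ, eᵢ]| ≤ (Σ_d |λ_d|)²`, `Σ'` denoting the restriction to
`(dᵢ, eⱼ) = 1` for `i ≠ j` (the printed `O(1)` per pair of nonzero `λ_d, λ_e` is here the explicit
`1` of `abs_cnt_sub_le`; the printed bound `λ_max² (Σ_{d<R} τ_k(d))²` for the right side is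
`sum_abs_lam_le_of_prod_le`). Hypothesis `hh`: every prime dividing some `hᵢ − hⱼ` (`i ≠ j`)
divides `W` (for fixed distinct `hᵢ` and `W = ∏_{p ≤ D₀} p` this holds once `D₀ ≥ max |hᵢ − hⱼ|`).
[cite: MaynardAnnals2015, proof of Lemma 5.1, (5.1)] -/
theorem abs_S1_sub_bilinear_le {W B : ℕ} (hW : W ≠ 0) {y : (Fin k → ℕ) → ℝ}
    (hy : SupportedOn W B y) {h : Fin k → ℤ}
    (hh : ∀ i j, i ≠ j → ∀ p : ℕ, p.Prime → (p : ℤ) ∣ h i - h j → p ∣ W) (v₀ N : ℕ) :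
    |S1 W B y h v₀ N - (N : ℝ) / W * ∑ d ∈ boxG k W B, ∑ e ∈ boxG k W B,
        (if ∀ p : OffDiag k, (d p.1.1).Coprime (e p.1.2) then
          lam B y d * lam B y e / ∏ i, (Nat.lcm (d i) (e i) : ℝ) else 0)| ≤
      (∑ d ∈ boxG k W B, |lam B y d|) ^ 2 := by
  rw [S1_eq_sum_boxG hy, Finset.mul_sum, ← Finset.sum_sub_distrib, sq, Finset.sum_mul_sum]
  refine (Finset.abs_sum_le_sum_abs _ _).trans (Finset.sum_le_sum fun d hd => ?_)
  rw [Finset.mul_sum, ← Finset.sum_sub_distrib]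
  refine (Finset.abs_sum_le_sum_abs _ _).trans (Finset.sum_le_sum fun e he => ?_)
  have hdG := (mem_boxG.1 hd).2
  have heG := (mem_boxG.1 he).2
  have hW' : (0 : ℝ) < W := by exact_mod_cast Nat.pos_of_ne_zero hW
  by_cases hc : ∀ p : OffDiag k, (d p.1.1).Coprime (e p.1.2)
  · rw [if_pos hc]
    have h1 := abs_cnt_sub_le hW hdG heG hc h v₀ N
    have hprod : 0 < ∏ i, (Nat.lcm (d i) (e i) : ℝ) :=
      Finset.prod_pos fun i _ => by
        exact_mod_cast Nat.pos_of_ne_zero (Nat.lcm_ne_zero (hdG.ne_zero i) (heG.ne_zero i))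
    have halg : lam B y d * lam B y e * (cnt W h v₀ N d e : ℝ) -
        (N : ℝ) / W * (lam B y d * lam B y e / ∏ i, (Nat.lcm (d i) (e i) : ℝ)) =
        (lam B y d * lam B y e) *
          ((cnt W h v₀ N d e : ℝ) - (N : ℝ) / ((W : ℝ) * ∏ i, (Nat.lcm (d i) (e i) : ℝ))) := by
      ring
    rw [halg, abs_mul, abs_mul]
    calc |lam B y d| * |lam B y e| *
          |(cnt W h v₀ N d e : ℝ) - (N : ℝ) / ((W : ℝ) * ∏ i, (Nat.lcm (d i) (e i) : ℝ))|
        ≤ |lam B y d| * |lam B y e| * 1 := by gcongr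
      _ = |lam B y d| * |lam B y e| := mul_one _
  · rw [if_neg hc]
    push Not at hc
    obtain ⟨p, hp⟩ := hc
    rw [cnt_eq_zero_of_not_coprime hh v₀ N hdG hp]
    simp only [Nat.cast_zero, mul_zero, sub_zero, abs_zero]
    positivity

/-- **Maynard 2015, Lemma 5.1, combinatorial form** (the printed statement
`S₁ = (N/W) Σ_u y_u²/∏ φ(uᵢ) + O(y_max² φ(W)^k N (log R)^k/(W^{k+1} D₀))` before the asymptotic
evaluation of the error constants): for `W ≥ 1`, `B ≥ 1`, `y` supported on good tuples of the box
`[1, B]^k` with `|y| ≤ y_max`, shifts `h` all of whose cross-differences have only prime factors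
dividing `W`, and any `v₀, N`,
`|S₁ − (N/W) Σ_u y_u²/∏ φ(uᵢ)| ≤ (N/W) y_max² L^k (Z^{k²−k} − 1) + (Σ_d |λ_d|)²`
with `L = Σ_{n ≤ B good} 1/φ(n)`, `Z = Σ_{n ≤ B good} 1/φ(n)²` (display (5.1) plus
`abs_S1main_sub_le` = (5.2)–(5.7)). [cite: MaynardAnnals2015, Lemma 5.1] -/
theorem abs_S1_sub_main_le {W B : ℕ} (hW : W ≠ 0) (hB : 1 ≤ B) {y : (Fin k → ℕ) → ℝ}
    (hy : SupportedOn W B y) {ymax : ℝ} (hymax : ∀ r, |y r| ≤ ymax) {h : Fin k → ℤ}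
    (hh : ∀ i j, i ≠ j → ∀ p : ℕ, p.Prime → (p : ℤ) ∣ h i - h j → p ∣ W) (v₀ N : ℕ) :
    |S1 W B y h v₀ N - (N : ℝ) / W * ∑ u ∈ boxG k W B, y u ^ 2 / ∏ i, ((u i).totient : ℝ)| ≤
      (N : ℝ) / W * (ymax ^ 2 * (∑ n ∈ G1 W B, 1 / (n.totient : ℝ)) ^ k *
          ((∑ n ∈ G1 W B, 1 / (n.totient : ℝ) ^ 2) ^ Fintype.card (OffDiag k) - 1)) +
        (∑ d ∈ boxG k W B, |lam B y d|) ^ 2 := by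
  have h1 := abs_S1_sub_bilinear_le hW hy hh v₀ N
  have h2 := abs_S1main_sub_le hB hy hymax
  have hW' : (0 : ℝ) ≤ (N : ℝ) / W := by positivity
  have h3 : |(N : ℝ) / W * (∑ d ∈ boxG k W B, ∑ e ∈ boxG k W B,
        (if ∀ p : OffDiag k, (d p.1.1).Coprime (e p.1.2) then
          lam B y d * lam B y e / ∏ i, (Nat.lcm (d i) (e i) : ℝ) else 0)) -
      (N : ℝ) / W * ∑ u ∈ boxG k W B, y u ^ 2 / ∏ i, ((u i).totient : ℝ)| ≤
      (N : ℝ) / W * (ymax ^ 2 * (∑ n ∈ G1 W B, 1 / (n.totient : ℝ)) ^ k *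
          ((∑ n ∈ G1 W B, 1 / (n.totient : ℝ) ^ 2) ^ Fintype.card (OffDiag k) - 1)) := by
    rw [← mul_sub, abs_mul, abs_of_nonneg hW']
    exact mul_le_mul_of_nonneg_left h2 hW'
  calc _ ≤ _ := abs_sub_le _ ((N : ℝ) / W * ∑ d ∈ boxG k W B, ∑ e ∈ boxG k W B,
        (if ∀ p : OffDiag k, (d p.1.1).Coprime (e p.1.2) then
          lam B y d * lam B y e / ∏ i, (Nat.lcm (d i) (e i) : ℝ) else 0)) _
    _ ≤ _ := by linarith [h1, h3]

/-! ### The size of `Σ_d |λ_d|` -/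

/-- If `λ_d ≠ 0` then `d` lies below some `r` of the support of `y`; so if `y` lives on tuples of
product `≤ X`, the support of `λ` is contained in the tuples of product `≤ X`
(Maynard 2015, proof of Lemma 5.1: "recalling ... the support of `λ`", the `Σ_{d<R} τ_k(d)` of
(5.1)). [cite: MaynardAnnals2015, proof of Lemma 5.1] -/
theorem prod_le_of_lam_ne_zero {W B : ℕ} {y : (Fin k → ℕ) → ℝ} (hy : SupportedOn W B y) {X : ℕ}
    (hyX : ∀ r, y r ≠ 0 → ∏ i, r i ≤ X) {d : Fin k → ℕ} (hd : lam B y d ≠ 0) :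
    ∏ i, d i ≤ X := by
  rw [lam_def] at hd
  have hsum := right_ne_zero_of_mul hd
  obtain ⟨r, hr, hne⟩ := Finset.exists_ne_zero_of_sum_ne_zero hsum
  rw [Finset.mem_filter] at hr
  have hyr : y r ≠ 0 := fun h0 => hne (by rw [h0, zero_div])
  have hrbox := (hy r hyr).1
  rw [mem_box] at hrbox
  refine le_trans ?_ (hyX r hyr)
  exact Finset.prod_le_prod (fun i _ => Nat.zero_le _) fun i _ =>
    Nat.le_of_dvd (hrbox i).1 (hr.2 i)

/-- **`Σ_d |λ_d| ≤ y_max L^{2k} · X (1 + log X)^{k−1}`** (`k ≥ 1`): the bound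
`λ_max · #supp(λ) ≤ λ_max Σ_{d ≤ X} τ_k(d)` of display (5.1), with `abs_lam_le`
(`λ_max ≤ y_max L^{2k}`) and `Literature.NumberTheory.Sieve.MaynardTao.card_prodLeTuples_le`.
[cite: MaynardAnnals2015, proof of Lemma 5.1, (5.1)] -/
theorem sum_abs_lam_le_of_prod_le (hk : 1 ≤ k) {W B : ℕ} {y : (Fin k → ℕ) → ℝ}
    (hy : SupportedOn W B y) {ymax : ℝ} (hymax : ∀ r, |y r| ≤ ymax) {X : ℕ}
    (hyX : ∀ r, y r ≠ 0 → ∏ i, r i ≤ X) :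
    ∑ d ∈ boxG k W B, |lam B y d| ≤
      ymax * (∑ e ∈ G1 W B, 1 / (e.totient : ℝ)) ^ (2 * k) * ((X : ℝ) * (1 + Real.log X) ^ (k - 1)) := by
  classical
  have hy0 : 0 ≤ ymax := le_trans (abs_nonneg _) (hymax fun _ => 1)
  have hL0 : 0 ≤ (∑ e ∈ G1 W B, 1 / (e.totient : ℝ)) := Finset.sum_nonneg fun _ _ => by positivity
  -- restrict to the support of `λ`, which lies in `prodLeTuples k X`
  rw [← Finset.sum_filter_of_ne (p := fun d => lam B y d ≠ 0)
    (fun d _ hne => fun h0 => hne (by rw [h0, abs_zero]))]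
  have hsub : (boxG k W B).filter (fun d => lam B y d ≠ 0) ⊆ MaynardTao.prodLeTuples k X := by
    intro d hd
    rw [Finset.mem_filter, mem_boxG, mem_box] at hd
    exact MaynardTao.mem_prodLeTuples_of (fun i => (hd.1.1 i).1) (prod_le_of_lam_ne_zero hy hyX hd.2)
  calc ∑ d ∈ (boxG k W B).filter (fun d => lam B y d ≠ 0), |lam B y d|
      ≤ ∑ d ∈ (boxG k W B).filter (fun d => lam B y d ≠ 0),
          ymax * (∑ e ∈ G1 W B, 1 / (e.totient : ℝ)) ^ (2 * k) :=
        Finset.sum_le_sum fun d _ => abs_lam_le hy hymax d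
    _ = (((boxG k W B).filter (fun d => lam B y d ≠ 0)).card : ℝ) *
          (ymax * (∑ e ∈ G1 W B, 1 / (e.totient : ℝ)) ^ (2 * k)) := by
        rw [Finset.sum_const, nsmul_eq_mul]
    _ ≤ ((MaynardTao.prodLeTuples k X).card : ℝ) *
          (ymax * (∑ e ∈ G1 W B, 1 / (e.totient : ℝ)) ^ (2 * k)) := by
        refine mul_le_mul_of_nonneg_right ?_ (by positivity)
        exact_mod_cast Finset.card_le_card hsub
    _ ≤ ((X : ℝ) * (1 + Real.log X) ^ (k - 1)) *
          (ymax * (∑ e ∈ G1 W B, 1 / (e.totient : ℝ)) ^ (2 * k)) := by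
        exact mul_le_mul_of_nonneg_right (MaynardTao.card_prodLeTuples_le k hk X) (by positivity)
    _ = _ := by ring

end MaynardSieve

/-! ### Application to Maynard's weights `λ_d = maynardWeight k F R W d` -/

/-- `maynardS1 = MaynardSieve.S1` for `B = ⌊R⌋`, `y = maynardY k F R W` (by `maynardWeight_eq_lam`;
the boxes agree by definition). [cite: MaynardAnnals2015, §4, definition of S₁ (p. 7)] -/
theorem maynardS1_eq_S1 (k : ℕ) (h : Fin k → ℤ) (F : (Fin k → ℝ) → ℝ) (R : ℝ) (W v₀ N : ℕ) :
    maynardS1 k h F R W v₀ N = MaynardSieve.S1 W ⌊R⌋₊ (maynardY k F R W) h v₀ N := by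
  simp only [maynardS1, maynardDivisorSum, maynardWeight_eq_lam]
  rfl

/-- Maynard's `y_r` (for any `F`) are supported on good tuples of the box `[1, ⌊R⌋]^k`
(`maynardY_eq`: the factors `μ(∏ rᵢ)²` and `1[(rᵢ, W) = 1]`; off the box the defining sum is
empty). [cite: MaynardAnnals2015, Lemma 5.1 ("y supported on ... square-free and coprime to W")] -/
theorem supportedOn_maynardY (k : ℕ) (F : (Fin k → ℝ) → ℝ) (R : ℝ) (W : ℕ) :
    MaynardSieve.SupportedOn W ⌊R⌋₊ (maynardY k F R W) := by
  intro r hr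
  by_cases hbox : r ∈ maynardBox k R
  · rw [maynardY_eq F R W hbox] at hr
    have hcop : ∀ i, Nat.Coprime (r i) W := by
      by_contra hc
      exact hr (if_neg hc)
    rw [if_pos hcop] at hr
    have hsq : Squarefree (∏ i, r i) := by
      by_contra hs
      apply hr
      rw [ArithmeticFunction.moebius_eq_zero_of_not_squarefree hs]
      simp
    exact ⟨hbox, hsq, Nat.Coprime.prod_left fun i _ => hcop i⟩
  · exfalso
    apply hr
    unfold maynardY
    have hempty : (maynardBox k R).filter (fun d => ∀ i, r i ∣ d i) = ∅ := by
      rw [Finset.filter_eq_empty_iff]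
      intro d hd hdvd
      apply hbox
      rw [mem_maynardBox_iff] at hd ⊢
      intro i
      refine ⟨Nat.pos_of_ne_zero fun h0 => ?_, (Nat.le_of_dvd (hd i).1 (hdvd i)).trans (hd i).2⟩
      have := hdvd i
      rw [h0, zero_dvd_iff] at this
      exact absurd (hd i).1 (by omega)
    rw [hempty, Finset.sum_empty, mul_zero]

/-- `|y_r| ≤ sup_{R_k} |G|` for `F = G · 1_{R_k}` (by `maynardY_eq`, `μ² ≤ 1`).
[cite: MaynardAnnals2015, Lemma 6.2 (y_max ≪ F_max)] -/
theorem abs_maynardY_le (k : ℕ) (G : (Fin k → ℝ) → ℝ) (R : ℝ) (W : ℕ) {Gmax : ℝ} (hG0 : 0 ≤ Gmax)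
    (hG : ∀ x ∈ maynardSimplex k, |G x| ≤ Gmax) (r : Fin k → ℕ) :
    |maynardY k ((maynardSimplex k).indicator G) R W r| ≤ Gmax := by
  by_cases hbox : r ∈ maynardBox k R
  · rw [maynardY_eq _ R W hbox, Set.indicator_indicator, Set.inter_self]
    split_ifs with hcop
    · rw [abs_mul]
      have hmu : |((μ (∏ i, r i) : ℤ) : ℝ) ^ 2| ≤ 1 := by
        rw [abs_pow, ← Int.cast_abs]
        by_cases hs : Squarefree (∏ i, r i)
        · rw [ArithmeticFunction.abs_moebius_eq_one_of_squarefree hs]; simp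
        · rw [ArithmeticFunction.moebius_eq_zero_of_not_squarefree hs]; simp
      have hF : |(maynardSimplex k).indicator G (fun i => Real.log (r i) / Real.log R)| ≤ Gmax := by
        by_cases hx : (fun i => Real.log (r i) / Real.log R) ∈ maynardSimplex k
        · rw [Set.indicator_of_mem hx]; exact hG _ hx
        · rw [Set.indicator_of_notMem hx, abs_zero]; exact hG0
      calc _ ≤ 1 * Gmax := mul_le_mul hmu hF (abs_nonneg _) zero_le_one
        _ = Gmax := one_mul _
    · rw [abs_zero]; exact hG0
  · have : maynardY k ((maynardSimplex k).indicator G) R W r = 0 := by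
      by_contra hne
      exact hbox (supportedOn_maynardY k _ R W r hne).1
    rw [this, abs_zero]; exact hG0

/-- For `F = G · 1_{R_k}` and `R > 1`: `y_r ≠ 0 ⇒ ∏ rᵢ ≤ ⌊R⌋` (the point `(log rᵢ/log R)ᵢ` lies in
the simplex, so `Σ log rᵢ ≤ log R`). [cite: MaynardAnnals2015, Lemma 5.1 (support ∏ rᵢ < R)] -/
theorem prod_le_of_maynardY_ne_zero (k : ℕ) (G : (Fin k → ℝ) → ℝ) {R : ℝ} (hR : 1 < R) (W : ℕ)
    {r : Fin k → ℕ} (hr : maynardY k ((maynardSimplex k).indicator G) R W r ≠ 0) :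
    ∏ i, r i ≤ ⌊R⌋₊ := by
  have hsupp := supportedOn_maynardY k ((maynardSimplex k).indicator G) R W r hr
  have hbox := hsupp.1
  rw [maynardY_eq _ R W hbox, Set.indicator_indicator, Set.inter_self] at hr
  by_cases hcop : ∀ i, Nat.Coprime (r i) W
  swap
  · rw [if_neg hcop] at hr
    exact absurd rfl hr
  rw [if_pos hcop] at hr
  have hx : (fun i => Real.log (r i) / Real.log R) ∈ maynardSimplex k := by
    by_contra hx
    exact hr (by rw [Set.indicator_of_notMem hx, mul_zero])
  have hlogR : 0 < Real.log R := Real.log_pos hR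
  have hpos : ∀ i, 0 < (r i : ℝ) := fun i => by
    have := (MaynardSieve.mem_box.1 hbox i).1
    exact_mod_cast this
  have hsum : ∑ i, Real.log (r i) ≤ Real.log R := by
    have := hx.2
    rw [← Finset.sum_div, div_le_one hlogR] at this
    exact this
  have hprod : ((∏ i, r i : ℕ) : ℝ) ≤ R := by
    push_cast
    rw [← Real.log_le_log_iff (Finset.prod_pos fun i _ => hpos i) (by linarith), Real.log_prod]
    · exact hsum
    · intro i _; exact (hpos i).ne'
  exact Nat.le_floor hprod

/-- **Maynard 2015, Lemma 5.1 for the weights of Prop. 4.1, non-asymptotic form**: for `k ≥ 1`,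
`R > 1`, `W ≥ 1`, `F = G · 1_{R_k}` with `|G| ≤ G_max` on `R_k`, shifts `h` whose cross-differences
have all prime factors dividing `W`, and any `v₀, N`,
`|S₁ − (N/W) Σ_{r} y_r²/∏ φ(rᵢ)| ≤ (N/W) G_max² L^k (Z^{k²−k} − 1) + (G_max L^{2k} ⌊R⌋ (1 + log ⌊R⌋)^{k−1})²`,
`L = Σ_{n ≤ R good} 1/φ(n)`, `Z = Σ_{n ≤ R good} 1/φ(n)²` (the sum over `r` running over the whole
box `maynardBox k R`, as in `Literature.NumberTheory.Sieve.maynard_lemma51`). [cite: MaynardAnnals2015, Lemma 5.1] -/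
theorem abs_maynardS1_sub_main_le {k : ℕ} (hk : 1 ≤ k) (h : Fin k → ℤ) (G : (Fin k → ℝ) → ℝ)
    {R : ℝ} (hR : 1 < R) {W : ℕ} (hW : W ≠ 0) {Gmax : ℝ} (hG0 : 0 ≤ Gmax)
    (hG : ∀ x ∈ maynardSimplex k, |G x| ≤ Gmax)
    (hh : ∀ i j, i ≠ j → ∀ p : ℕ, p.Prime → (p : ℤ) ∣ h i - h j → p ∣ W) (v₀ N : ℕ) :
    |maynardS1 k h ((maynardSimplex k).indicator G) R W v₀ N -
        (N : ℝ) / W * ∑ r ∈ maynardBox k R,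
          maynardY k ((maynardSimplex k).indicator G) R W r ^ 2 / ∏ i, (Nat.totient (r i) : ℝ)| ≤
      (N : ℝ) / W * (Gmax ^ 2 * (∑ n ∈ MaynardSieve.G1 W ⌊R⌋₊, 1 / (n.totient : ℝ)) ^ k *
          ((∑ n ∈ MaynardSieve.G1 W ⌊R⌋₊, 1 / (n.totient : ℝ) ^ 2) ^
              Fintype.card (MaynardSieve.OffDiag k) - 1)) +
        (Gmax * (∑ n ∈ MaynardSieve.G1 W ⌊R⌋₊, 1 / (n.totient : ℝ)) ^ (2 * k) *
          ((⌊R⌋₊ : ℝ) * (1 + Real.log ⌊R⌋₊) ^ (k - 1))) ^ 2 := by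
  have hB : 1 ≤ ⌊R⌋₊ := Nat.le_floor (by simpa using hR.le)
  have hy := supportedOn_maynardY k ((maynardSimplex k).indicator G) R W
  have hymax := abs_maynardY_le k G R W hG0 hG
  have hyX : ∀ r, maynardY k ((maynardSimplex k).indicator G) R W r ≠ 0 → ∏ i, r i ≤ ⌊R⌋₊ :=
    fun r hr => prod_le_of_maynardY_ne_zero k G hR W hr
  have h1 := MaynardSieve.abs_S1_sub_main_le hW hB hy hymax hh v₀ N
  have h2 := MaynardSieve.sum_abs_lam_le_of_prod_le hk hy hymax hyX
  -- the main term over `boxG` equals the main term over the whole box (`y = 0` off `boxG`)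
  have hbox : ∑ r ∈ maynardBox k R,
        maynardY k ((maynardSimplex k).indicator G) R W r ^ 2 / ∏ i, (Nat.totient (r i) : ℝ) =
      ∑ u ∈ MaynardSieve.boxG k W ⌊R⌋₊,
        maynardY k ((maynardSimplex k).indicator G) R W u ^ 2 / ∏ i, ((u i).totient : ℝ) := by
    symm
    refine Finset.sum_subset (Finset.filter_subset _ _) fun r hr hrG => ?_
    have : maynardY k ((maynardSimplex k).indicator G) R W r = 0 := by
      by_contra hne
      exact hrG (MaynardSieve.mem_boxG.2 (hy r hne))
    rw [this]; simp
  rw [maynardS1_eq_S1, hbox]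
  have h0 : 0 ≤ ∑ d ∈ MaynardSieve.boxG k W ⌊R⌋₊,
      |MaynardSieve.lam ⌊R⌋₊ (maynardY k ((maynardSimplex k).indicator G) R W) d| :=
    Finset.sum_nonneg fun _ _ => abs_nonneg _
  have h3 := pow_le_pow_left₀ h0 h2 2
  linarith [h1, h3]

end Literature.NumberTheory.Sieve
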